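import Literature.NumberTheory.Transcendental.KZCalculusProofs
import Mathlib.MeasureTheory.Integral.Pi
import Mathlib.Analysis.SpecialFunctions.Integrals.Basic

/-!
# Value of a log-box (crux `VolumeFormOffPlane`, line `Sketch`, stub `stub_logBoxValue`)

For `0 < a_j < b_j` the integrand-`1` Kontsevich–Zagier representation on the log-box
`B(a, b) = {p : Fin (n + 1) → ℝ | a_j < p_j < b_j (j < n), 0 < z, z · ∏_j p_j < 1}` (`z` the last,
"slack", coordinate) has value `∏_j log (b_j / a_j)`: the value is the volume of `B(a, b)`;
splitting off the slack coordinate (volume-preserving `MeasurableEquiv.piFinSuccAbove`), the fibre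
over a point `x` of the box `∏_j (a_j, b_j)` is the interval `(0, (∏_j x_j)⁻¹)`, so
`volume B = ∫_{box} (∏_j x_j)⁻¹ dx = ∏_j ∫_{a_j}^{b_j} dt / t = ∏_j log (b_j / a_j)` (Fubini over the
box coordinates, `MeasureTheory.integral_fintype_prod_eq_prod`, and `integral_inv_of_pos`).
-/

noncomputable section

open MeasureTheory Set
open Literature.NumberTheory.Transcendental

namespace Summit.KontsevichZagierPeriods.SymplecticScissors.LogPolytope

/-- `∫_{(a, b)} dt / t = log (b / a)` for `0 < a < b`. [folklore] -/
theorem lbv_setIntegral_inv_Ioo {a b : ℝ} (ha : 0 < a) (hab : a < b) :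
    ∫ t in Ioo a b, t⁻¹ = Real.log (b / a) := by
  rw [← integral_Ioc_eq_integral_Ioo, ← intervalIntegral.integral_of_le hab.le,
    integral_inv_of_pos ha (ha.trans hab)]

/-- `t ↦ t⁻¹` is integrable on the bounded interval `(a, b)` when `0 < a`. [folklore] -/
theorem lbv_integrableOn_inv_Ioo {a b : ℝ} (ha : 0 < a) :
    IntegrableOn (fun t : ℝ => t⁻¹) (Ioo a b) := by
  have hc : ContinuousOn (fun t : ℝ => t⁻¹) (Icc a b) :=
    continuousOn_inv₀.mono fun t ht => by
      simp only [mem_compl_iff, mem_singleton_iff]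
      exact (ha.trans_le ht.1).ne'
  exact hc.integrableOn_Icc.mono_set Ioo_subset_Icc_self

/-- Fubini over the box coordinates: `∫_{∏_j (a_j, b_j)} (∏_j x_j)⁻¹ dx = ∏_j log (b_j / a_j)` for
`0 < a_j < b_j`. [folklore] -/
theorem lbv_setIntegral_box {n : ℕ} (a b : Fin n → ℝ) (ha : ∀ j, 0 < a j) (hab : ∀ j, a j < b j) :
    ∫ x in Set.pi univ (fun j => Ioo (a j) (b j)), (∏ j, x j)⁻¹ = ∏ j, Real.log (b j / a j) := by
  calc ∫ x in Set.pi univ (fun j => Ioo (a j) (b j)), (∏ j, x j)⁻¹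
      = ∫ x, ∏ j, (x j)⁻¹ ∂(Measure.pi fun j => (volume : Measure ℝ).restrict (Ioo (a j) (b j))) := by
        rw [volume_pi, Measure.restrict_pi_pi]
        simp only [Finset.prod_inv_distrib]
    _ = ∏ j, ∫ t in Ioo (a j) (b j), t⁻¹ :=
        integral_fintype_prod_eq_prod (𝕜 := ℝ) (fun (_ : Fin n) (t : ℝ) => t⁻¹)
    _ = ∏ j, Real.log (b j / a j) :=
        Finset.prod_congr rfl fun j _ => lbv_setIntegral_inv_Ioo (ha j) (hab j)

/-- `(∏_j x_j)⁻¹` is integrable on the bounded box `∏_j (a_j, b_j)` when `0 < a_j` (a product of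
integrable one-variable factors). [folklore] -/
theorem lbv_integrableOn_box {n : ℕ} (a b : Fin n → ℝ) (ha : ∀ j, 0 < a j) :
    IntegrableOn (fun x : Fin n → ℝ => (∏ j, x j)⁻¹) (Set.pi univ (fun j => Ioo (a j) (b j))) := by
  rw [IntegrableOn, volume_pi, Measure.restrict_pi_pi]
  simp only [← Finset.prod_inv_distrib]
  exact Integrable.fintype_prod (f := fun (_ : Fin n) (t : ℝ) => t⁻¹)
    fun j => lbv_integrableOn_inv_Ioo (ha j) (b := b j)

/-- The volume of the log-box `{a_j < x_j < b_j, 0 < z, z · ∏_j x_j < 1} ⊆ ℝⁿ⁺¹` (`z` the last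
coordinate) is `∏_j log (b_j / a_j)` for `0 < a_j < b_j`: split off the last coordinate, whose fibre
over a point `x` of the box is `(0, (∏_j x_j)⁻¹)`, then integrate `(∏_j x_j)⁻¹` over the box.
[folklore] -/
theorem lbv_volume_logBox {n : ℕ} (a b : Fin n → ℝ) (ha : ∀ j, 0 < a j) (hab : ∀ j, a j < b j)
    (B : Set (Fin (n + 1) → ℝ)) (hBm : MeasurableSet B)
    (hB : B = {p : Fin (n + 1) → ℝ | (∀ j : Fin n, a j < p (Fin.castSucc j) ∧
      p (Fin.castSucc j) < b j) ∧ 0 < p (Fin.last n) ∧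
      p (Fin.last n) * ∏ j : Fin n, p (Fin.castSucc j) < 1}) :
    volume B = ENNReal.ofReal (∏ j, Real.log (b j / a j)) := by
  -- split off the last coordinate
  set e : (Fin (n + 1) → ℝ) ≃ᵐ ℝ × (Fin n → ℝ) :=
    MeasurableEquiv.piFinSuccAbove (fun _ => ℝ) (Fin.last n) with he_def
  have he : MeasurePreserving e volume volume :=
    volume_preserving_piFinSuccAbove (fun _ => ℝ) (Fin.last n)
  have he_symm : ∀ p : ℝ × (Fin n → ℝ), e.symm p = Fin.snoc p.2 p.1 := fun p => by
    simp [he_def, MeasurableEquiv.piFinSuccAbove, Fin.snocEquiv]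
  -- membership in the log-box, fibrewise
  have hmem : ∀ (x : Fin n → ℝ) (t : ℝ), (Fin.snoc x t : Fin (n + 1) → ℝ) ∈ B ↔
      (∀ j, a j < x j ∧ x j < b j) ∧ 0 < t ∧ t * ∏ j, x j < 1 := by
    intro x t
    rw [hB]
    simp only [mem_setOf_eq, Fin.snoc_castSucc, Fin.snoc_last]
  have hboxm : MeasurableSet (Set.pi univ (fun j => Ioo (a j) (b j)) : Set (Fin n → ℝ)) :=
    MeasurableSet.univ_pi fun _ => measurableSet_Ioo
  have hmem_box : ∀ x : Fin n → ℝ, x ∈ Set.pi univ (fun j => Ioo (a j) (b j)) ↔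
      ∀ j, a j < x j ∧ x j < b j := fun x => by
    simp only [mem_univ_pi, mem_Ioo]
  -- the fibres of the log-box over the box coordinates
  have hfib : ∀ x : Fin n → ℝ, volume {t : ℝ | (Fin.snoc x t : Fin (n + 1) → ℝ) ∈ B} =
      (Set.pi univ (fun j => Ioo (a j) (b j))).indicator
        (fun x : Fin n → ℝ => ENNReal.ofReal (∏ j, x j)⁻¹) x := by
    intro x
    by_cases hx : x ∈ Set.pi univ (fun j => Ioo (a j) (b j))
    · rw [indicator_of_mem hx]
      have hx' := (hmem_box x).1 hx
      have hP : 0 < ∏ j, x j := Finset.prod_pos fun j _ => (ha j).trans (hx' j).1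
      have hset : {t : ℝ | (Fin.snoc x t : Fin (n + 1) → ℝ) ∈ B} = Ioo 0 (∏ j, x j)⁻¹ := by
        ext t
        simp only [mem_setOf_eq, mem_Ioo]
        rw [hmem, ← one_div, lt_div_iff₀ hP]
        exact ⟨fun h => h.2, fun h => ⟨hx', h⟩⟩
      rw [hset, Real.volume_Ioo, sub_zero]
    · rw [indicator_of_notMem hx]
      have hset : {t : ℝ | (Fin.snoc x t : Fin (n + 1) → ℝ) ∈ B} = ∅ :=
        eq_empty_of_forall_notMem fun t ht => hx ((hmem_box x).2 ((hmem x t).1 ht).1)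
      rw [hset, measure_empty]
  -- nonnegativity and integrability of `(∏ x_j)⁻¹` on the box
  have hnn : 0 ≤ᵐ[volume.restrict (Set.pi univ (fun j => Ioo (a j) (b j)))]
      fun x : Fin n → ℝ => (∏ j, x j)⁻¹ := by
    filter_upwards [ae_restrict_mem hboxm] with x hx
    exact inv_nonneg.mpr
      (Finset.prod_nonneg fun j _ => ((ha j).trans ((hmem_box x).1 hx j).1).le)
  have hint : Integrable (fun x : Fin n → ℝ => (∏ j, x j)⁻¹)
      (volume.restrict (Set.pi univ (fun j => Ioo (a j) (b j)))) :=
    lbv_integrableOn_box a b ha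
  calc volume B = volume (e.symm ⁻¹' B) := ((he.symm e).measure_preimage_equiv B).symm
    _ = ∫⁻ x, volume ((fun t => (t, x)) ⁻¹' (e.symm ⁻¹' B)) := by
        rw [Measure.volume_eq_prod, Measure.prod_apply_symm (hBm.preimage e.symm.measurable)]
    _ = ∫⁻ x, (Set.pi univ (fun j => Ioo (a j) (b j))).indicator
          (fun x : Fin n → ℝ => ENNReal.ofReal (∏ j, x j)⁻¹) x := by
        refine lintegral_congr fun x => ?_
        rw [← hfib x]
        congr 1
        ext t
        simp only [mem_preimage, mem_setOf_eq, he_symm]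
    _ = ∫⁻ x in Set.pi univ (fun j => Ioo (a j) (b j)), ENNReal.ofReal (∏ j, x j)⁻¹ :=
        lintegral_indicator hboxm _
    _ = ENNReal.ofReal (∫ x in Set.pi univ (fun j => Ioo (a j) (b j)), (∏ j, x j)⁻¹) :=
        (ofReal_integral_eq_lintegral_ofReal hint hnn).symm
    _ = ENNReal.ofReal (∏ j, Real.log (b j / a j)) := by rw [lbv_setIntegral_box a b ha hab]

/-- **Value of a log-box.** For `0 < a_j < b_j` the integrand-`1` representation on the
log-box `{a_j < x_j < b_j, 0 < z, z · ∏ x_j < 1} ⊆ ℝⁿ⁺¹` has value `∏_j log (b_j / a_j)` (Fubini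
along the slack coordinate, then `∫_{a}^{b} dx / x = log (b / a)` in each box coordinate).
[folklore] -/
theorem stub_logBoxValue : ∀ (n : ℕ) (a b : Fin n → ℝ), (∀ j, 0 < a j) → (∀ j, a j < b j) →
    ∀ (r : KZ.IntegralRep (n + 1)),
    r.domain = {p : Fin (n + 1) → ℝ | (∀ j : Fin n, a j < p (Fin.castSucc j) ∧
      p (Fin.castSucc j) < b j) ∧ 0 < p (Fin.last n) ∧
      p (Fin.last n) * ∏ j : Fin n, p (Fin.castSucc j) < 1} →
    (∀ p ∈ r.domain, r.integrand p = 1) →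
    r.value = ∏ j : Fin n, Real.log (b j / a j) := by
  intro n a b ha hab r hdom h1
  have hBm : MeasurableSet r.domain := KZ.IntegralRep.measurableSet_domain_holds r
  -- the value of an integrand-`1` representation is the volume of its domain
  have hval : r.value = (volume r.domain).toReal := by
    rw [KZ.IntegralRep.value, setIntegral_congr_fun hBm h1, setIntegral_const, smul_eq_mul,
      mul_one, measureReal_def]
  rw [hval, lbv_volume_logBox a b ha hab r.domain hBm hdom, ENNReal.toReal_ofReal]
  exact Finset.prod_nonneg fun j _ => Real.log_nonneg ((one_le_div (ha j)).mpr (hab j).le)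

end Summit.KontsevichZagierPeriods.SymplecticScissors.LogPolytope

end
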